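import Mathlib
import Summits.ValiantsHypothesis.ValiantsHypothesis.Theorems.RigidityForcesSymmetryRankRigidMinimalReprLaplaceFiveTilings

/-!
# Unit tilings of `𝔖₅` by ten Young blocks, II — the six families, the converse, split types, the sharing-pair corollary
# (crux `RankRigidMinimalRepr`, stmt-ValiantsHypothesis-18034; frontier rung `LaplaceOptimalFive`, stmt-24813; first rung of
#  K1 «odd surfacing» of the line «shallow-collision ledger» on 24813, crux idea `twin-span-depth` (ii))

Companion of `…LaplaceFiveTilingsDefs.lean` / `…LaplaceFiveTilings.lean` (vocabulary `pairOf`, `interI`, `compatI`, `pivotList`,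
`memF1 … memF6`, `ALL`, `tilingsI`, `tilings` from there).  Results:

* `mem_pivotList_F1 … _F6`, `mem_tilingsI_iff` — the members of `tilingsI` are exactly the block sets described by the six
  predicates `memFᵢ` (F5/F6 with disjoint parameter pairs);
* `isTilingI_of_mem_tilingsI`, `isTilingI_iff_mem_tilingsI` — **a set of indexed Young blocks tiles `𝔖₅` iff it is one of the
  `520` members of `tilingsI`** (coverage by a kernel certificate over the `120` permutations, disjointness by `compatI_disjoint`);
* `ALL_splitType₁/₂` — the split types `(10)`, `(1¹⁰)`, `(7,1,1,1)`, `(4,1⁶)`, `(3,3,1⁴)`, `(4,2,2,2)` of F1–F6;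
* `sharing_pairI` / `sharing_pair` — **every unit tiling other than a letter-Laplace tiling has a split carrying two of its blocks
  whose letter pairs share exactly one letter** (the unit-level «cheap ⇒ depth-one cut-junk» at `d = 5` of the idea card (ii); at
  `d = 6` the analogue fails for the halving tiling), and the dual statement `sharing_pairI_dual`;
* `card_tilings : tilings.card = 520`, `tiling_classification`, `isTiling_iff_mem_tilings` — the same for block sets written as
  `Finset (Finset (Fin 5) × Finset (Fin 5))`, in the vocabulary of `LaplaceOptimal 5` (`S.image v = A`).

HONEST FRAMING: finite combinatorics (helper toward K1 `odd_surfacing_five`); `LaplaceOptimalFive` (stmt-24813) stays OPEN; nothing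
here bears on `VP ≠ VNP`, which is NOT proved.
-/

set_option autoImplicit false

-- the mandated summit-side namespace repeats a component by design (single-problem summit)
set_option linter.dupNamespace false

namespace Summit.ValiantsHypothesis.ValiantsHypothesis.Theorems.RigidityForcesSymmetryRankRigidMinimalRepr

namespace LaplaceFiveTilings

open Finset Function

/-! ### §1 The six families, descriptively -/

/-- Every indexed block is listed in `blocks`. -/
theorem mem_blocks : ∀ b : Fin 10 × Fin 10, b ∈ blocks := by decide +kernel

/-- Reading of the certificate `listsExactly`. -/
theorem mem_iff_of_listsExactly {L : List (Fin 10 × Fin 10)} {mem : Fin 10 × Fin 10 → Bool}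
    (h : listsExactly L mem = true) (b : Fin 10 × Fin 10) : b ∈ L ↔ mem b = true := by
  simp only [listsExactly, Bool.and_eq_true, List.all_eq_true, Bool.or_eq_true, Bool.not_eq_true',
    List.any_eq_true, beq_iff_eq] at h
  refine ⟨fun hb => h.1 b hb, fun hb => ?_⟩
  rcases h.2 b (mem_blocks b) with h' | ⟨b', hb', rfl⟩
  · rw [hb] at h'; exact absurd h' (by decide)
  · exact hb'

/-- The pivot-ordered list of an F1 member IS that member: membership is the descriptive predicate. -/
theorem mem_pivotList_F1 (s₀ : Fin 10) (b : Fin 10 × Fin 10) : b ∈ pivotList (memF1 s₀) ↔ memF1 s₀ b = true := by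
  have h : ∀ s₀, listsExactly (pivotList (memF1 s₀)) (memF1 s₀) = true := by decide +kernel
  exact mem_iff_of_listsExactly (h s₀) b

/-- Same for F2. -/
theorem mem_pivotList_F2 (l : Fin 10) (b : Fin 10 × Fin 10) : b ∈ pivotList (memF2 l) ↔ memF2 l b = true := by
  have h : ∀ l, listsExactly (pivotList (memF2 l)) (memF2 l) = true := by decide +kernel
  exact mem_iff_of_listsExactly (h l) b

/-- Same for F3. -/
theorem mem_pivotList_F3 (s₀ l : Fin 10) (b : Fin 10 × Fin 10) : b ∈ pivotList (memF3 s₀ l) ↔ memF3 s₀ l b = true := by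
  have h : ∀ s₀ l, listsExactly (pivotList (memF3 s₀ l)) (memF3 s₀ l) = true := by decide +kernel
  exact mem_iff_of_listsExactly (h s₀ l) b

/-- Same for F4. -/
theorem mem_pivotList_F4 (s₀ l : Fin 10) (b : Fin 10 × Fin 10) : b ∈ pivotList (memF4 s₀ l) ↔ memF4 s₀ l b = true := by
  have h : ∀ s₀ l, listsExactly (pivotList (memF4 s₀ l)) (memF4 s₀ l) = true := by decide +kernel
  exact mem_iff_of_listsExactly (h s₀ l) b

/-- Same for F5 (disjoint `s₁`, `s₂`). -/
theorem mem_pivotList_F5 (l s₁ s₂ : Fin 10) (hd : interI s₁ s₂ = 0) (b : Fin 10 × Fin 10) :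
    b ∈ pivotList (memF5 l s₁ s₂) ↔ memF5 l s₁ s₂ b = true := by
  have h : ∀ l s₁ s₂, interI s₁ s₂ = 0 → listsExactly (pivotList (memF5 l s₁ s₂)) (memF5 l s₁ s₂) = true := by
    decide +kernel
  exact mem_iff_of_listsExactly (h l s₁ s₂ hd) b

/-- Same for F6 (disjoint `m₁`, `m₂`). -/
theorem mem_pivotList_F6 (s₀ m₁ m₂ : Fin 10) (hd : interI m₁ m₂ = 0) (b : Fin 10 × Fin 10) :
    b ∈ pivotList (memF6 s₀ m₁ m₂) ↔ memF6 s₀ m₁ m₂ b = true := by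
  have h : ∀ s₀ m₁ m₂, interI m₁ m₂ = 0 → listsExactly (pivotList (memF6 s₀ m₁ m₂)) (memF6 s₀ m₁ m₂) = true := by
    decide +kernel
  exact mem_iff_of_listsExactly (h s₀ m₁ m₂ hd) b

/-- **The six families**: a set of indexed blocks is a listed tiling iff it is a member of F1–F6. -/
theorem mem_tilingsI_iff (T : Finset (Fin 10 × Fin 10)) : T ∈ tilingsI ↔
    (∃ s₀, T = (pivotList (memF1 s₀)).toFinset) ∨ (∃ l, T = (pivotList (memF2 l)).toFinset) ∨
    (∃ s₀ l, T = (pivotList (memF3 s₀ l)).toFinset) ∨ (∃ s₀ l, T = (pivotList (memF4 s₀ l)).toFinset) ∨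
    (∃ l s₁ s₂, s₁ < s₂ ∧ interI s₁ s₂ = 0 ∧ T = (pivotList (memF5 l s₁ s₂)).toFinset) ∨
    (∃ s₀ m₁ m₂, m₁ < m₂ ∧ interI m₁ m₂ = 0 ∧ T = (pivotList (memF6 s₀ m₁ m₂)).toFinset) := by
  simp only [tilingsI, ALL, ALL1, ALL2, ALL3, ALL4, ALL5, ALL6, List.mem_toFinset, List.mem_map, List.mem_append,
    List.mem_flatMap, List.mem_finRange, List.mem_filter, true_and, Bool.and_eq_true, decide_eq_true_eq,
    beq_iff_eq, eq_comm (a := T)]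
  constructor
  · rintro ⟨L, hL, rfl⟩
    rcases hL with ((((⟨s₀, rfl⟩ | ⟨l, rfl⟩) | ⟨s₀, l, rfl⟩) | ⟨s₀, l, rfl⟩) | ⟨l, s₁, s₂, ⟨h1, h2⟩, rfl⟩) | ⟨s₀, m₁, m₂, ⟨h1, h2⟩, rfl⟩
    · exact Or.inl ⟨s₀, rfl⟩
    · exact Or.inr (Or.inl ⟨l, rfl⟩)
    · exact Or.inr (Or.inr (Or.inl ⟨s₀, l, rfl⟩))
    · exact Or.inr (Or.inr (Or.inr (Or.inl ⟨s₀, l, rfl⟩)))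
    · exact Or.inr (Or.inr (Or.inr (Or.inr (Or.inl ⟨l, s₁, s₂, h1, h2, rfl⟩))))
    · exact Or.inr (Or.inr (Or.inr (Or.inr (Or.inr ⟨s₀, m₁, m₂, h1, h2, rfl⟩))))
  · rintro (⟨s₀, rfl⟩ | ⟨l, rfl⟩ | ⟨s₀, l, rfl⟩ | ⟨s₀, l, rfl⟩ | ⟨l, s₁, s₂, h1, h2, rfl⟩ | ⟨s₀, m₁, m₂, h1, h2, rfl⟩)
    · exact ⟨_, Or.inl (Or.inl (Or.inl (Or.inl (Or.inl ⟨s₀, rfl⟩)))), rfl⟩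
    · exact ⟨_, Or.inl (Or.inl (Or.inl (Or.inl (Or.inr ⟨l, rfl⟩)))), rfl⟩
    · exact ⟨_, Or.inl (Or.inl (Or.inl (Or.inr ⟨s₀, l, rfl⟩))), rfl⟩
    · exact ⟨_, Or.inl (Or.inl (Or.inr ⟨s₀, l, rfl⟩)), rfl⟩
    · exact ⟨_, Or.inl (Or.inr ⟨l, s₁, s₂, ⟨h1, h2⟩, rfl⟩), rfl⟩
    · exact ⟨_, Or.inr ⟨s₀, m₁, m₂, ⟨h1, h2⟩, rfl⟩, rfl⟩

/-! ### §2 The listed block sets are tilings -/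

/-- Kernel certificate: every listed tiling COVERS every permutation (`120 × 520 × 10` table lookups). -/
theorem ALL_cover_cert : (perms5.all fun v => coveredByAll (sigVec v) ALL) = true := by decide +kernel

/-- Reading of the signature vector. -/
theorem sigVec_getD (v : Fin 5 → Fin 5) : ∀ s : Fin 10, (sigVec v).getD s.val 0 = sig v s := by
  intro s; fin_cases s <;> rfl

/-- Every listed tiling covers every permutation. -/
theorem ALL_cover : ∀ L ∈ ALL, ∀ v ∈ perms5, ∃ b ∈ L, sig v b.1 = b.2 := by
  intro L hL v hv
  have h := List.all_eq_true.1 (List.all_eq_true.1 ALL_cover_cert v hv) L hL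
  obtain ⟨b, hb, hbeq⟩ := List.any_eq_true.1 h
  exact ⟨b, hb, by rw [← sigVec_getD]; simpa using hbeq⟩

/-- Kernel certificate: the blocks of every listed tiling are pairwise compatible. -/
theorem ALL_pairwise : ∀ L ∈ ALL, L.Pairwise fun b b' => compatI b b' = true := by decide +kernel

/-- Every permutation word is listed in `perms5`. -/
theorem mem_perms5 {v : Fin 5 → Fin 5} (hv : Function.Injective v) : v ∈ perms5 := by
  rw [perms5, List.mem_map]
  refine ⟨List.ofFn v, ?_, ?_⟩
  · rw [List.mem_permutations']
    apply List.perm_of_nodup_nodup_toFinset_eq (List.nodup_ofFn.2 hv) (List.nodup_finRange 5)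
    ext x
    simp only [List.mem_toFinset, List.mem_ofFn, List.mem_finRange, iff_true]
    exact (Finite.surjective_of_injective hv) x
  · funext i
    fin_cases i <;> rfl

/-- The slot-signature names the block: `sig v s = a` iff `v` maps `pairOf s` onto `pairOf a` (`v` injective). -/
theorem sig_eq_iff {v : Fin 5 → Fin 5} (hv : Function.Injective v) (s a : Fin 10) :
    sig v s = a ↔ (pairOf s).image v = pairOf a := by
  obtain ⟨hs, hne⟩ := pairOf_eq_lo_hi s
  have himg : (pairOf s).image v = pairOf (sig v s) := by
    rw [hs, Finset.image_insert, Finset.image_singleton, sig, pairOf_pairIdx _ _ (hv.ne hne)]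
  rw [himg]
  exact ⟨fun h => by rw [h], fun h => pairOf_injective h⟩

/-- **Every listed block set is a unit tiling.** -/
theorem isTilingI_of_mem_tilingsI {𝒯 : Finset (Fin 10 × Fin 10)} (h : 𝒯 ∈ tilingsI) :
    ∀ v : Fin 5 → Fin 5, Function.Injective v → ∃! b, b ∈ 𝒯 ∧ (pairOf b.1).image v = pairOf b.2 := by
  rw [tilingsI, List.mem_toFinset, List.mem_map] at h
  obtain ⟨L, hL, rfl⟩ := h
  intro v hv
  obtain ⟨b, hb, hsig⟩ := ALL_cover L hL v (mem_perms5 hv)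
  refine ⟨b, ⟨List.mem_toFinset.2 hb, (sig_eq_iff hv _ _).1 hsig⟩, ?_⟩
  rintro b' ⟨hb', himg'⟩
  by_contra hne
  haveI : Std.Symm fun b b' : Fin 10 × Fin 10 => compatI b b' = true := ⟨fun x y hxy => (compatI_symm y x).trans hxy⟩
  have hc := (ALL_pairwise L hL).forall (List.mem_toFinset.1 hb') hb hne
  exact compatI_disjoint hc hv himg' ((sig_eq_iff hv _ _).1 hsig)

/-- **A set of indexed Young blocks tiles `𝔖₅` iff it is one of the `520` listed tilings.** -/
theorem isTilingI_iff_mem_tilingsI (𝒯 : Finset (Fin 10 × Fin 10)) :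
    (∀ v : Fin 5 → Fin 5, Function.Injective v → ∃! b, b ∈ 𝒯 ∧ (pairOf b.1).image v = pairOf b.2) ↔ 𝒯 ∈ tilingsI :=
  ⟨mem_tilingsI_of_isTilingI, isTilingI_of_mem_tilingsI⟩

/-! ### §3 Split types and the sharing-pair corollary -/

/-- **SHARING PAIR** (index form): every unit tiling is a letter-Laplace tiling (all blocks on one letter pair), or some split
carries two of its blocks whose letter pairs share exactly one letter — the depth-one configuration of `pair_depth_dichotomy`. -/
theorem sharing_pairI {𝒯 : Finset (Fin 10 × Fin 10)}
    (h : ∀ v : Fin 5 → Fin 5, Function.Injective v → ∃! b, b ∈ 𝒯 ∧ (pairOf b.1).image v = pairOf b.2) :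
    (∃ l, ∀ b ∈ 𝒯, b.2 = l) ∨ ∃ b ∈ 𝒯, ∃ b' ∈ 𝒯, b.1 = b'.1 ∧ interI b.2 b'.2 = 1 := by
  have key : ∀ L ∈ ALL, (∃ l, ∀ b ∈ L, b.2 = l) ∨ ∃ b ∈ L, ∃ b' ∈ L, b.1 = b'.1 ∧ interI b.2 b'.2 = 1 := by
    decide +kernel
  have h' := mem_tilingsI_of_isTilingI h
  rw [tilingsI, List.mem_toFinset, List.mem_map] at h'
  obtain ⟨L, hL, rfl⟩ := h'
  simpa only [List.mem_toFinset] using key L hL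

/-- The dual corollary: every unit tiling is a slot-Laplace tiling (all blocks on one split), or some letter pair is carried by
two of its blocks whose splits share exactly one slot. -/
theorem sharing_pairI_dual {𝒯 : Finset (Fin 10 × Fin 10)}
    (h : ∀ v : Fin 5 → Fin 5, Function.Injective v → ∃! b, b ∈ 𝒯 ∧ (pairOf b.1).image v = pairOf b.2) :
    (∃ s₀, ∀ b ∈ 𝒯, b.1 = s₀) ∨ ∃ b ∈ 𝒯, ∃ b' ∈ 𝒯, b.2 = b'.2 ∧ interI b.1 b'.1 = 1 := by
  have key : ∀ L ∈ ALL, (∃ s₀, ∀ b ∈ L, b.1 = s₀) ∨ ∃ b ∈ L, ∃ b' ∈ L, b.2 = b'.2 ∧ interI b.1 b'.1 = 1 := by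
    decide +kernel
  have h' := mem_tilingsI_of_isTilingI h
  rw [tilingsI, List.mem_toFinset, List.mem_map] at h'
  obtain ⟨L, hL, rfl⟩ := h'
  simpa only [List.mem_toFinset] using key L hL

/-- The split types of F1, F2, F3 are `(10)`, `(1¹⁰)`, `(7,1,1,1)`. -/
theorem ALL_splitType₁ : (∀ L ∈ ALL1, splitType L = [10]) ∧ (∀ L ∈ ALL2, splitType L = [1, 1, 1, 1, 1, 1, 1, 1, 1, 1]) ∧
    (∀ L ∈ ALL3, splitType L = [7, 1, 1, 1]) := by
  refine ⟨?_, ?_, ?_⟩ <;> decide +kernel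

/-- The split types of F4, F5, F6 are `(4,1⁶)`, `(3,3,1⁴)`, `(4,2,2,2)`. -/
theorem ALL_splitType₂ : (∀ L ∈ ALL4, splitType L = [4, 1, 1, 1, 1, 1, 1]) ∧
    (∀ L ∈ ALL5, splitType L = [3, 3, 1, 1, 1, 1]) ∧ (∀ L ∈ ALL6, splitType L = [4, 2, 2, 2]) := by
  refine ⟨?_, ?_, ?_⟩ <;> decide +kernel

/-! ### §4 The same statements for blocks given as pairs of `2`-subsets of `Fin 5` -/

/-- **Exactly `520` unit tilings.** -/
theorem card_tilings : tilings.card = 520 := by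
  rw [tilings, Finset.card_image_of_injective _ (Finset.image_injective
    (Function.Injective.prodMap pairOf_injective pairOf_injective)), card_tilingsI]

/-- **CLASSIFICATION (set form).**  If a finite set `𝒯` of pairs `(S, A)` of `2`-subsets of `Fin 5` is a unit tiling — every
injective word `v` has exactly one `(S, A) ∈ 𝒯` with `v(S) = A` — then `𝒯` is one of the `520` members of `tilings`. -/
theorem tiling_classification (𝒯 : Finset (Finset (Fin 5) × Finset (Fin 5)))
    (hcard : ∀ b ∈ 𝒯, b.1.card = 2 ∧ b.2.card = 2)
    (htile : ∀ v : Fin 5 → Fin 5, Function.Injective v → ∃! b, b ∈ 𝒯 ∧ b.1.image v = b.2) : 𝒯 ∈ tilings := by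
  classical
  set 𝒯ᵢ : Finset (Fin 10 × Fin 10) := 𝒯.image (Prod.map idxOf idxOf) with h𝒯ᵢ
  have hround : ∀ b ∈ 𝒯, Prod.map pairOf pairOf (Prod.map idxOf idxOf b) = b := fun b hb =>
    Prod.ext (pairOf_idxOf _ (hcard b hb).1) (pairOf_idxOf _ (hcard b hb).2)
  have hback : 𝒯ᵢ.image (Prod.map pairOf pairOf) = 𝒯 := by
    rw [h𝒯ᵢ, Finset.image_image]
    ext b
    simp only [Finset.mem_image, Function.comp]
    constructor
    · rintro ⟨b', hb', rfl⟩; rw [hround b' hb']; exact hb'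
    · intro hb; exact ⟨b, hb, hround b hb⟩
  have hI : ∀ v : Fin 5 → Fin 5, Function.Injective v → ∃! b, b ∈ 𝒯ᵢ ∧ (pairOf b.1).image v = pairOf b.2 := by
    intro v hv
    obtain ⟨b, ⟨hb, hbv⟩, huniq⟩ := htile v hv
    refine ⟨Prod.map idxOf idxOf b, ⟨Finset.mem_image_of_mem _ hb, ?_⟩, ?_⟩
    · show (pairOf (idxOf b.1)).image v = pairOf (idxOf b.2)
      rw [pairOf_idxOf _ (hcard b hb).1, pairOf_idxOf _ (hcard b hb).2, hbv]
    · rintro c ⟨hc, hcv⟩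
      rw [h𝒯ᵢ, Finset.mem_image] at hc
      obtain ⟨b', hb', rfl⟩ := hc
      have : b' = b := huniq b' ⟨hb', by
        have h1 := pairOf_idxOf _ (hcard b' hb').1
        have h2 := pairOf_idxOf _ (hcard b' hb').2
        simp only [Prod.map_fst, Prod.map_snd] at hcv
        rwa [h1, h2] at hcv⟩
      rw [this]
  rw [tilings, Finset.mem_image]
  exact ⟨𝒯ᵢ, mem_tilingsI_of_isTilingI hI, hback⟩

/-- **A set of pairs of `2`-subsets is a unit tiling iff it is one of the `520` listed ones.** -/
theorem isTiling_iff_mem_tilings (𝒯 : Finset (Finset (Fin 5) × Finset (Fin 5))) :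
    ((∀ b ∈ 𝒯, b.1.card = 2 ∧ b.2.card = 2) ∧
      ∀ v : Fin 5 → Fin 5, Function.Injective v → ∃! b, b ∈ 𝒯 ∧ b.1.image v = b.2) ↔ 𝒯 ∈ tilings := by
  constructor
  · exact fun h => tiling_classification 𝒯 h.1 h.2
  · intro h
    rw [tilings, Finset.mem_image] at h
    obtain ⟨T, hT, rfl⟩ := h
    refine ⟨fun b hb => ?_, fun v hv => ?_⟩
    · rw [Finset.mem_image] at hb
      obtain ⟨c, -, rfl⟩ := hb
      exact ⟨pairOf_card _, pairOf_card _⟩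
    · obtain ⟨c, ⟨hc, hcv⟩, huniq⟩ := isTilingI_of_mem_tilingsI hT v hv
      refine ⟨Prod.map pairOf pairOf c, ⟨Finset.mem_image_of_mem _ hc, hcv⟩, ?_⟩
      rintro b ⟨hb, hbv⟩
      rw [Finset.mem_image] at hb
      obtain ⟨c', hc', rfl⟩ := hb
      rw [huniq c' ⟨hc', hbv⟩]

/-- **SHARING PAIR (set form).**  A unit tiling is a letter-Laplace tiling `{(S, L)}_S`, or some split `S` carries two blocks
`(S, A), (S, A')` of it with `|A ∩ A'| = 1` — two letter blocks sharing a letter, whose mirror junk has collision depth one. -/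
theorem sharing_pair (𝒯 : Finset (Finset (Fin 5) × Finset (Fin 5)))
    (hcard : ∀ b ∈ 𝒯, b.1.card = 2 ∧ b.2.card = 2)
    (htile : ∀ v : Fin 5 → Fin 5, Function.Injective v → ∃! b, b ∈ 𝒯 ∧ b.1.image v = b.2) :
    (∃ L : Finset (Fin 5), ∀ b ∈ 𝒯, b.2 = L) ∨
      ∃ b ∈ 𝒯, ∃ b' ∈ 𝒯, b.1 = b'.1 ∧ (b.2 ∩ b'.2).card = 1 := by
  have h := tiling_classification 𝒯 hcard htile
  rw [tilings, Finset.mem_image] at h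
  obtain ⟨T, hT, rfl⟩ := h
  rcases sharing_pairI (isTilingI_of_mem_tilingsI hT) with ⟨l, hl⟩ | ⟨b, hb, b', hb', h1, h2⟩
  · refine Or.inl ⟨pairOf l, fun b hb => ?_⟩
    rw [Finset.mem_image] at hb
    obtain ⟨c, hc, rfl⟩ := hb
    exact congrArg pairOf (hl c hc)
  · refine Or.inr ⟨_, Finset.mem_image_of_mem _ hb, _, Finset.mem_image_of_mem _ hb', ?_, ?_⟩
    · exact congrArg pairOf h1
    · show (pairOf b.2 ∩ pairOf b'.2).card = 1
      rw [← interI_spec, h2]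

end LaplaceFiveTilings

end Summit.ValiantsHypothesis.ValiantsHypothesis.Theorems.RigidityForcesSymmetryRankRigidMinimalRepr
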